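import Literature.NumberTheory.Transcendental.ComplexFormsHighType
import HarnessLib

/-!
# No forms of type `(p, q)` with `p > dim_ℂ E` or `q > dim_ℂ E`; off-type forms vanish on complex subspaces

Topic: complex-valued forms on complex manifolds (`ComplexForms.lean`: `IsOfType p q` is the pointwise
weight condition `α(e^{iθ}v₁, …, e^{iθ}v_k) = e^{i(p-q)θ} α(v)`; `hodgePQ E M k p q ⊆ H^k_dR(M; ℂ)`).
Companion to `ComplexFormsHighType`, which treats the pure types `(p, 0)`, `(0, q)` beyond the
dimension and leaves the MIXED types open ("the weight `p - q` alone does not detect them"). They are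
treated here, with the consequence used by the threshold lemma of the Hodge summit's route
*HolomorphicityRate* ("an off-type `(r, s)`-form dies on complex `(n - p)`-planes"):

* `eq_zero_of_weight_sub_of_finrank_lt` (and `eq_zero_of_weight_of_finrank_lt_fst`, degree-`k`
  form): **a real-alternating `(p + q)`-form of weight `p - q` on a complex vector space of dimension
  `< p` is zero** (`Λ^{p,q} E^* = Λ^p (E^{1,0})^* ⊗ Λ^q (E^{0,1})^* = 0` for `p > dim_ℂ E`; Voisin
  (2002), §2.3.1, eq. (2.4)). Proof by induction on `q`: the `(0,1)`-part in the first slot,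
  `x ↦ φ(x, ·) + i φ(ix, ·)`, is a `(p + q - 1)`-form of weight `p - (q - 1)`, zero by induction, so
  `φ` is `ℂ`-linear in the first slot, hence (alternating) in every slot, hence of weight
  `p + q ≠ p - q` — unless `q = 0`, the case of `ComplexFormsHighType` (`eq_zero_of_weight_of_finrank_lt`);
* `eq_zero_of_weight_of_finrank_lt_snd`: the same for `q > dim_ℂ E` (complex conjugation);
* `IsOfType.eq_zero_of_finrank_lt_fst/snd`, `hodgePQ_eq_bot_of_finrank_lt_fst/snd`: hence no
  non-zero forms, and no classes, of type `(p, q)` on a manifold charted on `E` once `p > dim_ℂ E`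
  or `q > dim_ℂ E` (Voisin (2002), Rem. 2.24);
* `apply_eq_zero_of_weight_of_forall_mem`: **an off-type form vanishes on complex subspaces of half
  its degree**: a `k`-form of weight `p - q`, `p + q = k`, `p ≠ q`, vanishes on every `k`-tuple of
  vectors of a complex subspace `W` with `2 dim_ℂ W = k` (restricted to `W` it is of type `(p, q)`
  with `p > dim W` or `q > dim W`); `IsOfType.apply_eq_zero_of_forall_mem` is the manifold form, for a
  `J`-stable real subspace of a tangent space (Harvey–Lawson (1982), §II.1: only the `(k,k)`-part of
  a `2k`-form survives on complex `k`-planes — the linear algebra behind Wirtinger's inequality).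

No definitions, no named facts.

## References

* C. Voisin, *Hodge Theory and Complex Algebraic Geometry I* (2002), §2.3.1 (eq. (2.4), Rem. 2.24).
* R. Harvey, H. B. Lawson, *Calibrated geometries*, Acta Math. 148 (1982), §II.1.
* Mathlib: `ContinuousAlternatingMap.curryLeft`, `AlternatingMap.map_swap`, `MultilinearMap.map_smul_univ`.
-/

noncomputable section

open scoped Manifold ContDiff Topology ComplexConjugate
open Set Function Finset

namespace Literature.NumberTheory.Transcendental

/-! ### Scalar lemmas -/

/-- If `e^{iaθ} z = e^{ibθ} z` for all real `θ` and the integers `a ≠ b`, then `z = 0`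
(at `θ = π / (a - b)` the two exponentials differ by the factor `e^{iπ} = -1`). [folklore] -/
theorem eq_zero_of_forall_cexp_int_mul_eq {a b : ℤ} (hab : a ≠ b) {z : ℂ}
    (h : ∀ θ : ℝ, Complex.exp ((a : ℂ) * θ * Complex.I) * z =
      Complex.exp ((b : ℂ) * θ * Complex.I) * z) :
    z = 0 := by
  by_contra hz
  set θ : ℝ := Real.pi / ((a : ℝ) - b) with hθ
  have hab' : ((a : ℝ) - b) ≠ 0 := sub_ne_zero.2 (by exact_mod_cast hab)
  have key : Complex.exp ((a : ℂ) * θ * Complex.I) = Complex.exp ((b : ℂ) * θ * Complex.I) :=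
    mul_right_cancel₀ hz (h θ)
  -- `e^{iaθ} = e^{ibθ} e^{i(a-b)θ} = e^{ibθ} e^{iπ} = -e^{ibθ}`
  have hsplit : (a : ℂ) * θ * Complex.I = (b : ℂ) * θ * Complex.I + (Real.pi : ℂ) * Complex.I := by
    have : ((a : ℝ) - b) * θ = Real.pi := by rw [hθ]; field_simp
    have hc : ((a : ℂ) - b) * (θ : ℂ) = (Real.pi : ℂ) := by exact_mod_cast this
    linear_combination Complex.I * hc
  rw [hsplit, Complex.exp_add, Complex.exp_pi_mul_I, mul_neg_one] at key
  have hne : Complex.exp ((b : ℂ) * θ * Complex.I) ≠ 0 := Complex.exp_ne_zero _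
  exact hne (by linear_combination (-1 : ℂ) / 2 * key)

/-- `conj (e^{-iθ}) = e^{iθ}`. [folklore] -/
theorem conj_cexp_neg_mul_I (θ : ℝ) :
    conj (Complex.exp (-(θ * Complex.I))) = Complex.exp (θ * Complex.I) := by
  rw [← Complex.exp_conj, map_neg, map_mul, Complex.conj_ofReal, Complex.conj_I, mul_neg, neg_neg]

/-! ### Pointwise: weight `p - q` in `p + q` slots with `p > dim` forces zero -/

section Pointwise

variable {E : Type*} [NormedAddCommGroup E] [NormedSpace ℂ E]

/-- A real-linear map `f : E → ℂ` with `f(ix) = -i f(x)` is conjugate-linear: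
`f(c x) = conj c · f(x)`. [folklore] -/
theorem map_smul_eq_conj_mul (f : E →ₗ[ℝ] ℂ) (hf : ∀ x, f (Complex.I • x) = -(Complex.I * f x))
    (c : ℂ) (x : E) : f (c • x) = conj c * f x := by
  have h1 : c • x = (c.re : ℝ) • x + (c.im : ℝ) • (Complex.I • x) := by
    conv_lhs => rw [← Complex.re_add_im c]
    rw [add_smul, mul_smul, Complex.coe_smul, Complex.coe_smul]
  rw [h1, map_add, f.map_smul, f.map_smul, hf, Complex.real_smul, Complex.real_smul]
  conv_rhs => rw [← Complex.re_add_im c]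
  rw [map_add, map_mul, Complex.conj_ofReal, Complex.conj_ofReal, Complex.conj_I]
  ring

/-- A real-alternating form which is `ℂ`-linear in every slot scales by `cᵏ` under `c ∈ ℂ`:
`φ(c v₁, …, c v_k) = cᵏ φ(v)` (`MultilinearMap.map_smul_univ` for the associated `ℂ`-multilinear
map). [folklore] -/
theorem apply_smul_of_forall_update_I {k : ℕ} (φ : E [⋀^Fin k]→L[ℝ] ℂ)
    (hI : ∀ (v : Fin k → E) (j : Fin k), φ (update v j (Complex.I • v j)) = Complex.I * φ v)
    (c : ℂ) (v : Fin k → E) : φ (fun i ↦ c • v i) = c ^ k * φ v := by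
  let ψ : MultilinearMap ℂ (fun _ : Fin k ↦ E) ℂ :=
    { toFun := φ
      map_update_add' := fun v i x y ↦ φ.map_update_add v i x y
      map_update_smul' := fun v i c x ↦ by
        convert map_update_smul_complex_of_forall_update_I φ hI v i c x }
  have hψ : ∀ w, ψ w = φ w := fun w ↦ rfl
  rw [← hψ, ← hψ, ψ.map_smul_univ (fun _ ↦ c) v, Finset.prod_const, Finset.card_univ,
    Fintype.card_fin, smul_eq_mul]

/-- `ℂ`-linearity in the first slot propagates to every slot of a real-alternating form (by the
transposition `(0 j)`, under which the form is odd). [folklore] -/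
theorem apply_update_I_smul_of_apply_update_zero {m : ℕ} (φ : E [⋀^Fin (m + 1)]→L[ℝ] ℂ)
    (h0 : ∀ v : Fin (m + 1) → E, φ (update v 0 (Complex.I • v 0)) = Complex.I * φ v)
    (v : Fin (m + 1) → E) (j : Fin (m + 1)) :
    φ (update v j (Complex.I • v j)) = Complex.I * φ v := by
  rcases eq_or_ne j 0 with rfl | hj
  · exact h0 v
  · have hswap : ∀ w : Fin (m + 1) → E, φ (w ∘ Equiv.swap 0 j) = -φ w := fun w ↦
      φ.toAlternatingMap.map_swap w hj.symm
    set v' : Fin (m + 1) → E := v ∘ Equiv.swap 0 j with hv'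
    have h1 : update v j (Complex.I • v j) ∘ Equiv.swap (0 : Fin (m + 1)) j =
        update v' 0 (Complex.I • v' 0) := by
      rw [update_comp_equiv, Equiv.symm_swap, Equiv.swap_apply_right, hv', Function.comp_apply,
        Equiv.swap_apply_left]
    have h2 : φ (update v j (Complex.I • v j)) = -φ (update v' 0 (Complex.I • v' 0)) := by
      rw [← h1, hswap, neg_neg]
    rw [h2, h0 v', hv', hswap]
    ring

variable [FiniteDimensional ℂ E]

/-- **`Λ^{p,q} E^* = 0` for `p > dim_ℂ E`**: a real-alternating complex-valued `(p + q)`-form of weight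
`p - q` under the rotations `e^{iθ}` (type `(p, q)`) on a complex vector space of dimension `< p` is
zero. Induction on `q`: the `(0,1)`-part of `φ` in the first slot, `ψ_x = φ(x, ·) + i φ(ix, ·)`, is a
`(p + q)`-form of weight `p - q` when `φ` has `p + (q + 1)` slots and weight `p - (q + 1)`
(`ψ_{c x} = conj c · ψ_x`), hence zero by induction; so `φ` is `ℂ`-linear in the first slot, hence
in every slot (alternating), hence of weight `p + q + 1 ≠ p - q - 1`, so `φ = 0`; the start `q = 0`
is `eq_zero_of_weight_of_finrank_lt` (`Λ^{p,0} = Λ^p_ℂ (E^{1,0})^*`). Voisin (2002), §2.3.1, eq. (2.4):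
`Ω^{p,q} = Λ^p Ω^{1,0} ⊗ Λ^q Ω^{0,1}`. [cite: VoisinHodgeI2002, §2.3.1] -/
theorem eq_zero_of_weight_sub_of_finrank_lt {p : ℕ} (hp : Module.finrank ℂ E < p) :
    ∀ (q : ℕ) (φ : E [⋀^Fin (p + q)]→L[ℝ] ℂ),
      (∀ (θ : ℝ) (v : Fin (p + q) → E), φ (fun i ↦ Complex.exp (θ * Complex.I) • v i) =
        Complex.exp ((((p : ℤ) - q : ℤ) : ℂ) * θ * Complex.I) * φ v) → φ = 0 := by
  intro q
  induction q with
  | zero =>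
    intro φ hφ
    refine eq_zero_of_weight_of_finrank_lt φ (fun θ v ↦ ?_) hp
    have hc : ((((p : ℤ) - ((0 : ℕ) : ℤ) : ℤ) : ℂ)) = ((p + 0 : ℕ) : ℂ) := by push_cast; ring
    exact hc ▸ hφ θ v
  | succ q ih =>
    intro φ hφ
    -- `f_u(x) = φ(x, u) + i φ(ix, u)`, real-linear and conjugate-linear in `x`
    let f : (Fin (p + q) → E) → E →ₗ[ℝ] ℂ := fun u ↦
      { toFun := fun x ↦ φ (Matrix.vecCons x u) + Complex.I * φ (Matrix.vecCons (Complex.I • x) u)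
        map_add' := fun x y ↦ by
          have h1 := congrArg (fun L : E [⋀^Fin (p + q)]→L[ℝ] ℂ ↦ L u) (φ.curryLeft.map_add x y)
          have h2 := congrArg (fun L : E [⋀^Fin (p + q)]→L[ℝ] ℂ ↦ L u)
            (φ.curryLeft.map_add (Complex.I • x) (Complex.I • y))
          simp only [ContinuousAlternatingMap.add_apply,
            ContinuousAlternatingMap.curryLeft_apply_apply] at h1 h2
          rw [smul_add, h1, h2]
          ring
        map_smul' := fun r x ↦ by
          have h1 := congrArg (fun L : E [⋀^Fin (p + q)]→L[ℝ] ℂ ↦ L u) (φ.curryLeft.map_smul r x)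
          have h2 := congrArg (fun L : E [⋀^Fin (p + q)]→L[ℝ] ℂ ↦ L u)
            (φ.curryLeft.map_smul r (Complex.I • x))
          simp only [ContinuousAlternatingMap.smul_apply,
            ContinuousAlternatingMap.curryLeft_apply_apply] at h1 h2
          rw [smul_comm Complex.I r x, h1, h2, RingHom.id_apply, Complex.real_smul,
            Complex.real_smul, Complex.real_smul]
          ring }
    have hf : ∀ u x, f u x = φ (Matrix.vecCons x u) + Complex.I * φ (Matrix.vecCons (Complex.I • x) u) :=
      fun u x ↦ rfl
    have hfI : ∀ u x, f u (Complex.I • x) = -(Complex.I * f u x) := by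
      intro u x
      rw [hf, hf, smul_smul, Complex.I_mul_I, neg_one_smul]
      have hneg : φ (Matrix.vecCons (-x) u) = -φ (Matrix.vecCons x u) := by
        have h1 := congrArg (fun L : E [⋀^Fin (p + q)]→L[ℝ] ℂ ↦ L u) (φ.curryLeft.map_neg x)
        simpa only [ContinuousAlternatingMap.neg_apply,
          ContinuousAlternatingMap.curryLeft_apply_apply] using h1
      rw [hneg]
      linear_combination (φ (Matrix.vecCons (Complex.I • x) u)) * Complex.I_mul_I
    -- the weight condition of `φ` read on `vecCons y u`
    have hrot : ∀ (θ : ℝ) (u : Fin (p + q) → E) (y : E),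
        φ (Matrix.vecCons (Complex.exp (θ * Complex.I) • y) (fun i ↦ Complex.exp (θ * Complex.I) • u i)) =
        Complex.exp ((((p : ℤ) - (q + 1 : ℕ) : ℤ) : ℂ) * θ * Complex.I) * φ (Matrix.vecCons y u) := by
      intro θ u y
      have h := hφ θ (Matrix.vecCons y u)
      refine Eq.trans (congrArg φ (funext fun i ↦ ?_)) h
      refine Fin.cases ?_ (fun j ↦ ?_) i
      · rfl
      · simp only [Matrix.cons_val_succ]
    -- hence `f_{e^{iθ} u}(x) = e^{i(p-q-1)θ} f_u(e^{-iθ} x) = e^{i(p-q)θ} f_u(x)`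
    have hweight : ∀ (θ : ℝ) (u : Fin (p + q) → E) (x : E),
        f (fun i ↦ Complex.exp (θ * Complex.I) • u i) x =
          Complex.exp ((((p : ℤ) - q : ℤ) : ℂ) * θ * Complex.I) * f u x := by
      intro θ u x
      have hzz : Complex.exp (θ * Complex.I) * Complex.exp (-(θ * Complex.I)) = 1 := by
        rw [← Complex.exp_add, add_neg_cancel, Complex.exp_zero]
      have hx : ∀ y : E, Complex.exp (θ * Complex.I) • (Complex.exp (-(θ * Complex.I)) • y) = y :=
        fun y ↦ by rw [smul_smul, hzz, one_smul]
      have e1 := hrot θ u (Complex.exp (-(θ * Complex.I)) • x)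
      have e2 := hrot θ u (Complex.exp (-(θ * Complex.I)) • (Complex.I • x))
      rw [hx] at e1 e2; rw [hf]; erw [e1, e2]
      rw [smul_comm (Complex.exp (-(θ * Complex.I))) Complex.I x, mul_left_comm Complex.I,
        ← mul_add, ← hf, map_smul_eq_conj_mul (f u) (hfI u), conj_cexp_neg_mul_I, ← mul_assoc,
        ← Complex.exp_add]
      congr 2; push_cast; ring
    -- by induction the `(p+q)`-forms `ψ_x = φ(x, ·) + i φ(ix, ·)` vanish
    have hψ : ∀ x u, f u x = 0 := by
      intro x u
      have h0 := ih (φ.curryLeft x + Complex.I • φ.curryLeft (Complex.I • x)) fun θ u ↦ by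
        have h := hweight θ u x
        simp only [hf] at h
        simp only [ContinuousAlternatingMap.add_apply, ContinuousAlternatingMap.smul_apply,
          ContinuousAlternatingMap.curryLeft_apply_apply, smul_eq_mul]
        exact h
      have h1 := congrArg (fun L : E [⋀^Fin (p + q)]→L[ℝ] ℂ ↦ L u) h0
      simp only [ContinuousAlternatingMap.add_apply, ContinuousAlternatingMap.smul_apply,
        ContinuousAlternatingMap.curryLeft_apply_apply, smul_eq_mul,
        ContinuousAlternatingMap.coe_zero, Pi.zero_apply] at h1
      exact (hf u x).trans h1
    -- so `φ` is `ℂ`-linear in the first slot, hence in every slot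
    have hlin0 : ∀ v : Fin (p + q + 1) → E, φ (update v 0 (Complex.I • v 0)) = Complex.I * φ v := by
      intro v
      have h := hψ (v 0) (Fin.tail v)
      rw [hf] at h
      have hv : φ v = φ (Matrix.vecCons (v 0) (Fin.tail v)) := by
        rw [Matrix.vecCons, Fin.cons_self_tail]
      have hv' : update v 0 (Complex.I • v 0) = Matrix.vecCons (Complex.I • v 0) (Fin.tail v) := by
        conv_lhs => rw [← Fin.cons_self_tail v]
        exact Fin.update_cons_zero _ _ _
      rw [hv', hv]
      linear_combination (-Complex.I) * h +
        φ (Matrix.vecCons (Complex.I • v 0) (Fin.tail v)) * Complex.I_mul_I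
    have hlin : ∀ (v : Fin (p + q + 1) → E) (j : Fin (p + q + 1)),
        φ (update v j (Complex.I • v j)) = Complex.I * φ v :=
      apply_update_I_smul_of_apply_update_zero φ hlin0
    -- two weights, `p + q + 1` and `p - q - 1`, for the same form: it vanishes
    ext v
    rw [ContinuousAlternatingMap.coe_zero, Pi.zero_apply]
    refine eq_zero_of_forall_cexp_int_mul_eq (a := ((p + q + 1 : ℕ) : ℤ))
      (b := (p : ℤ) - (q + 1 : ℕ)) (by push_cast; omega) fun θ ↦ ?_
    have h1 := apply_smul_of_forall_update_I φ hlin (Complex.exp (θ * Complex.I)) v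
    have h2 := hφ θ v
    rw [h1, ← Complex.exp_nat_mul] at h2
    have h3 : Complex.exp ((((p + q + 1 : ℕ) : ℤ) : ℂ) * θ * Complex.I) =
        Complex.exp (((p + q + 1 : ℕ) : ℂ) * (θ * Complex.I)) := by
      congr 1; push_cast; ring
    exact h3 ▸ h2

/-- **`Λ^{p,q} E^* = 0` for `p > dim_ℂ E`**, degree-`k` form: a real-alternating `k`-form of weight
`p - q`, `p + q = k`, on a complex vector space of dimension `< p` vanishes.
[cite: VoisinHodgeI2002, §2.3.1] -/
theorem eq_zero_of_weight_of_finrank_lt_fst {k p q : ℕ} (hk : p + q = k) (φ : E [⋀^Fin k]→L[ℝ] ℂ)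
    (hφ : ∀ (θ : ℝ) (v : Fin k → E), φ (fun i ↦ Complex.exp (θ * Complex.I) • v i) =
      Complex.exp ((((p : ℤ) - q : ℤ) : ℂ) * θ * Complex.I) * φ v)
    (hp : Module.finrank ℂ E < p) : φ = 0 := by
  subst hk
  exact eq_zero_of_weight_sub_of_finrank_lt hp q φ hφ

/-- **`Λ^{p,q} E^* = 0` for `q > dim_ℂ E`**: a real-alternating `k`-form of weight `p - q`, `p + q = k`,
on a complex vector space of dimension `< q` vanishes — its complex conjugate has weight `q - p`
(type `(q, p)`) and vanishes by `eq_zero_of_weight_of_finrank_lt_fst`.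
Voisin (2002), §2.3.1 (`Ω^{p,q} = conj Ω^{q,p}`). [cite: VoisinHodgeI2002, §2.3.1] -/
theorem eq_zero_of_weight_of_finrank_lt_snd {k p q : ℕ} (hk : p + q = k) (φ : E [⋀^Fin k]→L[ℝ] ℂ)
    (hφ : ∀ (θ : ℝ) (v : Fin k → E), φ (fun i ↦ Complex.exp (θ * Complex.I) • v i) =
      Complex.exp ((((p : ℤ) - q : ℤ) : ℂ) * θ * Complex.I) * φ v)
    (hq : Module.finrank ℂ E < q) : φ = 0 := by
  -- the conjugate form
  set φc : E [⋀^Fin k]→L[ℝ] ℂ :=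
    (Complex.conjCLE : ℂ ≃L[ℝ] ℂ).toContinuousLinearMap.compContinuousAlternatingMap φ with hφc
  have hφc_apply : ∀ v, φc v = conj (φ v) := fun v ↦ rfl
  have hc : φc = 0 := by
    refine eq_zero_of_weight_of_finrank_lt_fst (p := q) (q := p) (by omega) φc (fun θ v ↦ ?_) hq
    rw [hφc_apply, hφc_apply, hφ θ v, map_mul, ← Complex.exp_conj]
    congr 2
    simp only [map_mul, Complex.conj_ofReal, Complex.conj_I, ← Complex.ofReal_intCast]
    push_cast; ring
  ext v
  have h := congrArg (fun L : E [⋀^Fin k]→L[ℝ] ℂ ↦ conj (L v)) hc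
  simp only [hφc_apply, Complex.conj_conj, ContinuousAlternatingMap.coe_zero, Pi.zero_apply,
    map_zero] at h
  rw [h, ContinuousAlternatingMap.coe_zero, Pi.zero_apply]

/-- **An off-type form vanishes on complex subspaces of half its degree**: a real-alternating
`k`-form of weight `p - q` with `p + q = k`, `p ≠ q` (type `(p, q)`, off the middle type) vanishes on
every `k`-tuple of vectors of a complex subspace `W` with `2 dim_ℂ W = k` — restricted to `W` it is a
form of type `(p, q)` with `p > dim W` or `q > dim W`. This is "a form of type `(r, s)`, `r ≠ s`,
dies on complex `(r + s)/2`-planes", the pointwise fact behind Wirtinger's inequality and the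
`(k, k)`-calibrations. [cite: HarveyLawson1982, §II.1] [cite: VoisinHodgeI2002, §2.3.1] -/
theorem apply_eq_zero_of_weight_of_forall_mem {k p q : ℕ} (hk : p + q = k) (hpq : p ≠ q)
    (φ : E [⋀^Fin k]→L[ℝ] ℂ)
    (hφ : ∀ (θ : ℝ) (v : Fin k → E), φ (fun i ↦ Complex.exp (θ * Complex.I) • v i) =
      Complex.exp ((((p : ℤ) - q : ℤ) : ℂ) * θ * Complex.I) * φ v)
    (W : Submodule ℂ E) (hW : 2 * Module.finrank ℂ W = k) (v : Fin k → E) (hv : ∀ i, v i ∈ W) :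
    φ v = 0 := by
  -- restrict `φ` to `W`
  let ι : W →L[ℝ] E := (W.subtypeL).restrictScalars ℝ
  let φW : W [⋀^Fin k]→L[ℝ] ℂ := φ.compContinuousLinearMap ι
  have hφW_apply : ∀ w : Fin k → W, φW w = φ (fun i ↦ (w i : E)) := fun w ↦ rfl
  have hφW : ∀ (θ : ℝ) (w : Fin k → W), φW (fun i ↦ Complex.exp (θ * Complex.I) • w i) =
      Complex.exp ((((p : ℤ) - q : ℤ) : ℂ) * θ * Complex.I) * φW w := by
    intro θ w
    rw [hφW_apply, hφW_apply, ← hφ θ]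
    rfl
  have hzero : φW = 0 := by
    rcases lt_or_gt_of_ne hpq with h | h
    · exact eq_zero_of_weight_of_finrank_lt_snd hk φW hφW (by omega)
    · exact eq_zero_of_weight_of_finrank_lt_fst hk φW hφW (by omega)
  have h := hφW_apply (fun i ↦ ⟨v i, hv i⟩)
  rw [hzero, ContinuousAlternatingMap.coe_zero, Pi.zero_apply] at h
  exact h.symm

end Pointwise

/-! ### On a manifold: no forms and no classes of type `(p, q)` beyond the dimension -/

section Forms

variable {E : Type*} [NormedAddCommGroup E] [NormedSpace ℂ E] [FiniteDimensional ℂ E]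
  {M : Type*} [TopologicalSpace M] [ChartedSpace E M] {k : ℕ}

/-- **No non-zero forms of type `(p, q)` with `p > dim_ℂ E`** on a manifold charted on `E`
(pointwise `eq_zero_of_weight_of_finrank_lt_fst` on each tangent space `T_x M = E`); the mixed-type
extension of `IsOfType.eq_zero_of_finrank_lt_left`. Voisin (2002), §2.3.1, Rem. 2.24
(`Ω^{p,q}_X = 0` unless `p, q ≤ n`). [cite: VoisinHodgeI2002, §2.3.1] -/
theorem IsOfType.eq_zero_of_finrank_lt_fst {p q : ℕ} {α : Literature.Geometry.Kaehler.MForm 𝓘(ℝ, E) M ℂ k}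
    (hα : IsOfType p q α) (hp : Module.finrank ℂ E < p) : α = 0 := by
  funext x
  exact eq_zero_of_weight_of_finrank_lt_fst hα.1 (show E [⋀^Fin k]→L[ℝ] ℂ from α x)
    (fun θ v ↦ hα.2 x θ v) hp

/-- **No non-zero forms of type `(p, q)` with `q > dim_ℂ E`** on a manifold charted on `E`; the
mixed-type extension of `IsOfType.eq_zero_of_finrank_lt_right`. [cite: VoisinHodgeI2002, §2.3.1] -/
theorem IsOfType.eq_zero_of_finrank_lt_snd {p q : ℕ} {α : Literature.Geometry.Kaehler.MForm 𝓘(ℝ, E) M ℂ k}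
    (hα : IsOfType p q α) (hq : Module.finrank ℂ E < q) : α = 0 := by
  funext x
  exact eq_zero_of_weight_of_finrank_lt_snd hα.1 (show E [⋀^Fin k]→L[ℝ] ℂ from α x)
    (fun θ v ↦ hα.2 x θ v) hq

variable (M) in
/-- **`H^{p,q} = 0` in `H^k_dR(M; ℂ)` for `p > dim_ℂ E`** (every `(p, q)`): the span of the classes of
closed forms of type `(p, q)` is `⊥`, all such forms being `0`. For `M` compact Kähler of dimension
`n`: `H^{p,q}(M) = 0` unless `p, q ≤ n`. [cite: VoisinHodgeI2002, §2.3.1 and §6.1] -/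
theorem hodgePQ_eq_bot_of_finrank_lt_fst {p q : ℕ} (hp : Module.finrank ℂ E < p) :
    hodgePQ E M k p q = ⊥ := by
  rw [hodgePQ, Submodule.span_eq_bot]
  rintro _ ⟨α, hα, rfl⟩
  rw [show α = 0 from Subtype.ext (IsOfType.eq_zero_of_finrank_lt_fst
    (α := (α : Literature.Geometry.Kaehler.MForm 𝓘(ℝ, E) M ℂ k)) hα hp), map_zero]

variable (M) in
/-- **`H^{p,q} = 0` in `H^k_dR(M; ℂ)` for `q > dim_ℂ E`** (every `(p, q)`).
[cite: VoisinHodgeI2002, §2.3.1 and §6.1] -/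
theorem hodgePQ_eq_bot_of_finrank_lt_snd {p q : ℕ} (hq : Module.finrank ℂ E < q) :
    hodgePQ E M k p q = ⊥ := by
  rw [hodgePQ, Submodule.span_eq_bot]
  rintro _ ⟨α, hα, rfl⟩
  rw [show α = 0 from Subtype.ext (IsOfType.eq_zero_of_finrank_lt_snd
    (α := (α : Literature.Geometry.Kaehler.MForm 𝓘(ℝ, E) M ℂ k)) hα hq), map_zero]

/-- **Off-type forms die on complex planes** (manifold form): a form `α` of type `(p, q)` with
`p ≠ q` vanishes at `x` on every `(p + q)`-tuple of tangent vectors of a `J`-stable real subspace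
`V ⊆ T_x M` of real dimension `p + q` (`J = tangentJ E x`; `V` is then a complex subspace of
dimension `(p + q)/2`, on which `α_x` has type `(p, q)` with `p` or `q` beyond the dimension).
For the route *HolomorphicityRate* of the Hodge summit: the tangent plane `ker df_x` of a nearly
holomorphic cycle support of defect `0` is `J`-stable (`hasJDefectLE_zero_iff`), so closed off-type
forms integrate to zero over holomorphic chains. [cite: HarveyLawson1982, §II.1]
[cite: VoisinHodgeI2002, §2.3.1] -/
theorem IsOfType.apply_eq_zero_of_forall_mem {p q : ℕ} {α : Literature.Geometry.Kaehler.MForm 𝓘(ℝ, E) M ℂ k}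
    (hα : IsOfType p q α) (hpq : p ≠ q) (x : M) (V : Submodule ℝ E)
    (hV : ∀ v ∈ V, (Literature.Geometry.Kaehler.tangentJ E x v : E) ∈ V)
    (hdim : Module.finrank ℝ V = k) (v : Fin k → TangentSpace 𝓘(ℝ, E) x) (hv : ∀ i, (v i : E) ∈ V) :
    α x v = 0 := by
  -- `V` is the real subspace underlying a complex subspace `W`, of complex dimension `k / 2`
  let W : Submodule ℂ E :=
    { carrier := V
      add_mem' := V.add_mem
      zero_mem' := V.zero_mem
      smul_mem' := fun c w hw ↦ by
        have h1 : c • w = (c.re : ℝ) • w + (c.im : ℝ) • (Complex.I • w) := by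
          conv_lhs => rw [← Complex.re_add_im c]
          rw [add_smul, mul_smul, Complex.coe_smul, Complex.coe_smul]
        rw [h1]
        exact V.add_mem (V.smul_mem _ hw) (V.smul_mem _ (hV w hw)) }
  have hW : 2 * Module.finrank ℂ W = k := by
    have h1 : Module.finrank ℝ W = 2 * Module.finrank ℂ W := by
      rw [← Module.finrank_mul_finrank ℝ ℂ W, Complex.finrank_real_complex]
    have h2 : Module.finrank ℝ W = Module.finrank ℝ V :=
      LinearEquiv.finrank_eq (LinearEquiv.ofEq (W.restrictScalars ℝ) V rfl)
    omega
  exact apply_eq_zero_of_weight_of_forall_mem hα.1 hpq (show E [⋀^Fin k]→L[ℝ] ℂ from α x)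
    (fun θ v ↦ hα.2 x θ v) W hW v fun i ↦ hv i

end Forms


end Literature.NumberTheory.Transcendental

end
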